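import Summits.CriticalPhenomena.SAWScalingLimit.Theses.SAWBrickWallHomotopy
import Summits.CriticalPhenomena.SAWScalingLimit.Theorems.ObservableToSLE.Negative.CompactContainer
import Literature.Probability.RandomPlanarGeometry.SAWBrickWallHex
import Literature.Probability.Percolation.TriLoopWinding
import HarnessLib

/-!
# `ModulusUniversality`, line `birth`: the jittered drawing of the brick wall (stub L, layer 1)

Helper file (`--supports stmt-CriticalPhenomena-5790`) of the line `birth` / `registered` for the
crux `SAWBrickWallHomotopy.ModulusUniversality` (skeleton
`Summits/CriticalPhenomena/SAWScalingLimit/Cruxes/ModulusUniversality/Lines/birth.lean`): the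
registered helper sub-goal `dist_mk_polyline_straight_jittered_le` of the open stub L
(`stub_jitteredLipMerging`, bounded-Lipschitz merging of the straight and the jittered brick-wall
laws), proved — the purely geometric DRAWING COUPLING.

For the affinity `B(x + iy) = 2x + i(2/√3)y` of the line, the jittered honeycomb vertex
`B(c_{(x,k)})` (`c` = `hexCenter`, `k ∈ {0, 1}` the triangle type) is
`(2x₀ + x₁ + k + 1) + i(x₁ + (k+1)/3)` (`affinity_hexCenter`), i.e. the brick-wall site
`(2x₀ + x₁ + k + 1, x₁) ∈ ℤ²` displaced VERTICALLY by `(k+1)/3 ∈ {1/3, 2/3}`; the map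
`(x, k) ↦ (2x₀ + x₁ + k + 1, x₁)` is the position-compatible identification of the honeycomb
lattice with the brick wall (`hexGraph_adj_iff_brickWallGraph_adj`; NB the tree's `SAW.bwIso` is a
different, not position-compatible, isomorphism).  Hence at mesh `δ` the straight drawing (mesh
point `δ · site`) and the jittered drawing (`δ · B(c)`) of one vertex are `≤ 2|δ|/3` apart
(`dist_meshPoint_site_le`), and since `polyline` parametrises by list position only
(`ObservableToSLE.Negative.dist_polyline_map_le`), the straight and the jittered polylines of ONE
abstract walk are at `CurveClass` distance `≤ 2|δ|/3` (`dist_mk_polyline_straight_jittered_le`,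
the registered signature; corollaries `dist_toCurve_straight_jittered_le` for walks and
`abs_sub_le_of_lipschitz_straight_jittered` for an `L`-Lipschitz test function).  The site map is
written as the explicit vector `![2 * w.1 0 + w.1 1 + k + 1, w.1 1]` throughout (no definitions in
this file).  All bookkeeping tagged [folklore].
-/

noncomputable section

open MeasureTheory Filter Topology
open scoped NNReal
open Literature.Probability.LatticeModels
open Literature.Probability.RandomPlanarGeometry

namespace Summit.CriticalPhenomena.SAWScalingLimit.Cruxes.ModulusUniversality.Birth

/-! ### The position-compatible dictionary `hexGraph ↔ brickWallGraph` -/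

/-- **Honeycomb adjacency is brick-wall adjacency of the underlying sites** under
`(x, k) ↦ (2x₀ + x₁ + k + 1, x₁)` (the position-compatible identification of the honeycomb lattice
with the brick wall; it is a bijection on vertices, inverse `(m, n) ↦` type `1` of the cell
`((m - n - 2)/2, n)` if `m + n` is even, type `0` of `((m - n - 1)/2, n)` if odd). [folklore] -/
theorem hexGraph_adj_iff_brickWallGraph_adj (u v : HexVertex) :
    hexGraph.Adj u v ↔ SAW.brickWallGraph.Adj
      (![2 * u.1 0 + u.1 1 + ((u.2 : ℕ) : ℤ) + 1, u.1 1] : Site 2)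
      (![2 * v.1 0 + v.1 1 + ((v.2 : ℕ) : ℤ) + 1, v.1 1] : Site 2) := by
  obtain ⟨x, i⟩ := u
  obtain ⟨y, j⟩ := v
  rw [SAW.hexGraph_adj_iff_coord, SAW.brickWallGraph_adj_coord]
  simp only [Matrix.cons_val_zero, Matrix.cons_val_one, Matrix.cons_val_fin_one]
  fin_cases i <;> fin_cases j <;> simp <;> omega

/-! ### Positions: the jittered vertex sits `(k+1)/3` above its brick-wall site -/

open Literature.Probability.Percolation (hexCenter_re hexCenter_im) in
/-- **The jittered drawing in brick-wall coordinates**: for the affinity `B = diag(2, 2/√3)`,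
`B(c_{(x,k)}) = (2x₀ + x₁ + k + 1) + i (x₁ + (k+1)/3)`, i.e. the brick-wall site
`(2x₀ + x₁ + k + 1, x₁)` displaced vertically by `(k+1)/3`. [folklore] -/
theorem affinity_hexCenter {B : ℂ ≃ₜ ℂ}
    (hB : ∀ z : ℂ, B z = ((2 * z.re : ℝ) : ℂ) + ((2 / Real.sqrt 3 * z.im : ℝ) : ℂ) * Complex.I)
    (v : HexVertex) :
    B (hexCenter v) = Site.toComplex (![2 * v.1 0 + v.1 1 + ((v.2 : ℕ) : ℤ) + 1, v.1 1] : Site 2) +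
      (((((v.2 : ℕ) : ℝ) + 1) / 3 : ℝ) : ℂ) * Complex.I := by
  obtain ⟨x, k⟩ := v
  have h3 : Real.sqrt 3 ≠ 0 := (Real.sqrt_pos.2 (by norm_num : (0 : ℝ) < 3)).ne'
  rw [hB, hexCenter_re, hexCenter_im]
  apply Complex.ext
  · simp only [Complex.add_re, Complex.ofReal_re, Complex.mul_re, Complex.ofReal_im,
      Complex.I_re, Complex.I_im, mul_zero, Site.toComplex_re, Matrix.cons_val_zero, Int.cast_add,
      Int.cast_mul, Int.cast_ofNat, Int.cast_natCast, Int.cast_one, add_zero, mul_one, sub_self]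
    ring
  · simp only [Complex.add_im, Complex.ofReal_im, Complex.mul_im, Complex.ofReal_re,
      Complex.I_re, Complex.I_im, mul_zero, mul_one, zero_add, Site.toComplex_im,
      Matrix.cons_val_one, Matrix.cons_val_fin_one, add_zero]
    field_simp

/-- Hence, at mesh `δ`, the jittered vertex `δ B(c_v)` is the mesh point of the brick-wall site
displaced by `δ (k+1)/3 · i`. [folklore] -/
theorem mul_affinity_hexCenter {B : ℂ ≃ₜ ℂ}
    (hB : ∀ z : ℂ, B z = ((2 * z.re : ℝ) : ℂ) + ((2 / Real.sqrt 3 * z.im : ℝ) : ℂ) * Complex.I)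
    (δ : ℝ) (v : HexVertex) :
    (δ : ℂ) * B (hexCenter v) =
      meshPoint δ (![2 * v.1 0 + v.1 1 + ((v.2 : ℕ) : ℤ) + 1, v.1 1] : Site 2) +
        (δ : ℂ) * ((((((v.2 : ℕ) : ℝ) + 1) / 3 : ℝ) : ℂ) * Complex.I) := by
  rw [affinity_hexCenter hB, meshPoint, mul_add]

/-- **The jitter is at most `2δ/3`**: `dist (δ · site v, δ B(c_v)) = |δ| (k+1)/3 ≤ 2|δ|/3`.
[folklore] -/
theorem dist_meshPoint_site_le {B : ℂ ≃ₜ ℂ}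
    (hB : ∀ z : ℂ, B z = ((2 * z.re : ℝ) : ℂ) + ((2 / Real.sqrt 3 * z.im : ℝ) : ℂ) * Complex.I)
    (δ : ℝ) (v : HexVertex) :
    dist (meshPoint δ (![2 * v.1 0 + v.1 1 + ((v.2 : ℕ) : ℤ) + 1, v.1 1] : Site 2))
        ((δ : ℂ) * B (hexCenter v)) ≤ 2 * |δ| / 3 := by
  rw [mul_affinity_hexCenter hB, dist_eq_norm, sub_add_cancel_left, norm_neg, norm_mul,
    Complex.norm_real, Real.norm_eq_abs, norm_mul, Complex.norm_I, mul_one, Complex.norm_real,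
    Real.norm_eq_abs]
  have hk : (((v.2 : ℕ) : ℝ) + 1) / 3 ≤ 2 / 3 := by
    have : ((v.2 : ℕ) : ℝ) ≤ 1 := by
      have h := v.2.isLt
      exact_mod_cast Nat.lt_succ_iff.1 h
    linarith
  have hk0 : 0 ≤ (((v.2 : ℕ) : ℝ) + 1) / 3 := by positivity
  rw [abs_of_nonneg hk0]
  calc |δ| * ((((v.2 : ℕ) : ℝ) + 1) / 3) ≤ |δ| * (2 / 3) :=
        mul_le_mul_of_nonneg_left hk (abs_nonneg δ)
    _ = 2 * |δ| / 3 := by ring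

/-! ### The drawing coupling: the straight and the jittered polyline of ONE abstract walk -/

open Summit.CriticalPhenomena.SAWScalingLimit.Theorems.ObservableToSLE.Negative
  (dist_polyline_map_le) in
/-- **Drawing coupling (registered helper sub-goal of stub L, literal signature).** For the
affinity `B = diag(2, 2/√3)` and one abstract walk (vertex list `l` of honeycomb vertices), the
straight polyline through the brick-wall mesh points `δ · (2w₀ + w₁ + k + 1, w₁)` and the jittered
polyline through `δ B(c_w)` are at `CurveClass` distance `≤ 2|δ|/3`: same number of vertices,
corresponding vertices `≤ 2|δ|/3` apart (`dist_meshPoint_site_le`), and `polyline` parametrises by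
list position only (`dist_polyline_map_le`), after `CurveClass.dist_mk_mk` and
`Curve.dist_le_dist_toContinuousMap`. [folklore] -/
theorem dist_mk_polyline_straight_jittered_le : ∀ B : ℂ ≃ₜ ℂ, (∀ z : ℂ, B z = ((2 * z.re : ℝ) : ℂ) + ((2 / Real.sqrt 3 * z.im : ℝ) : ℂ) * Complex.I) → ∀ (δ : ℝ) (l : List HexVertex), dist (CurveClass.mk ⟨polyline (l.map fun w : HexVertex => meshPoint δ (![2 * w.1 0 + w.1 1 + ((w.2 : ℕ) : ℤ) + 1, w.1 1] : Site 2))⟩) (CurveClass.mk ⟨polyline (l.map fun w : HexVertex => (δ : ℂ) * B (hexCenter w))⟩) ≤ 2 * |δ| / 3 := by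
  intro B hB δ l
  rw [CurveClass.dist_mk_mk]
  refine (Curve.dist_le_dist_toContinuousMap _ _).trans ?_
  exact dist_polyline_map_le _ _ (by positivity) l fun v _ => dist_meshPoint_site_le hB δ v

/-- The jittered curve of a walk `p` of any graph on the honeycomb vertices (e.g. the jittered
discrete domain graph `embDomainGraph hexGraph (B ∘ hexCenter) E δ`) is the class of the jittered
polyline through its support (`SimpleGraph.Walk.toCurve`); the STRAIGHT drawing of the same
abstract walk is the polyline through the brick-wall mesh points of its support.  The two classes
are `≤ 2|δ|/3` apart. [folklore] -/
theorem dist_toCurve_straight_jittered_le {B : ℂ ≃ₜ ℂ}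
    (hB : ∀ z : ℂ, B z = ((2 * z.re : ℝ) : ℂ) + ((2 / Real.sqrt 3 * z.im : ℝ) : ℂ) * Complex.I)
    (δ : ℝ) {G : SimpleGraph HexVertex} {u v : HexVertex} (p : G.Walk u v) :
    dist (CurveClass.mk ⟨polyline ((p.support.map fun w : HexVertex =>
          (![2 * w.1 0 + w.1 1 + ((w.2 : ℕ) : ℤ) + 1, w.1 1] : Site 2)).map (meshPoint δ))⟩)
        (CurveClass.mk ⟨p.toCurve fun w => (δ : ℂ) * B (hexCenter w)⟩) ≤ 2 * |δ| / 3 := by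
  rw [List.map_map]
  exact dist_mk_polyline_straight_jittered_le B hB δ p.support

/-- **On an `L`-Lipschitz test function the jitter costs at most `L · 2|δ|/3`.** [folklore] -/
theorem abs_sub_le_of_lipschitz_straight_jittered {B : ℂ ≃ₜ ℂ}
    (hB : ∀ z : ℂ, B z = ((2 * z.re : ℝ) : ℂ) + ((2 / Real.sqrt 3 * z.im : ℝ) : ℂ) * Complex.I)
    (δ : ℝ) (l : List HexVertex) {g : CurveClass ℂ → ℝ} {L : ℝ≥0} (hg : LipschitzWith L g) :
    |g (CurveClass.mk ⟨polyline (l.map fun w : HexVertex =>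
          meshPoint δ (![2 * w.1 0 + w.1 1 + ((w.2 : ℕ) : ℤ) + 1, w.1 1] : Site 2))⟩) -
        g (CurveClass.mk ⟨polyline (l.map fun w : HexVertex => (δ : ℂ) * B (hexCenter w))⟩)| ≤
      L * (2 * |δ| / 3) := by
  rw [← Real.dist_eq]
  exact (hg.dist_le_mul _ _).trans
    (mul_le_mul_of_nonneg_left (dist_mk_polyline_straight_jittered_le B hB δ l) L.2)

end Summit.CriticalPhenomena.SAWScalingLimit.Cruxes.ModulusUniversality.Birth

end
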